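import Mathlib
import HarnessLib
import Summits.NavierStokesRegularity.NavierStokesRegularity.Theorems.UnthreadedDoorCellFluxGlue
import Summits.NavierStokesRegularity.NavierStokesRegularity.Theorems.UnthreadedDoorCellFluxGaugeRigidity
import Summits.NavierStokesRegularity.NavierStokesRegularity.Theorems.UnthreadedDoorCellFluxZonalVorticityVanishes

/-!
# Route `UnthreadedDoor`, crux `PoloidalLiouville` (stmt-NavierStokesRegularity-1222), WALL W1 — crux idea «cell-flux» (ns-idea-14):
# `UnthreadedAnalyticOrIrrotational` — UNCONDITIONAL (Σ-5a + Z, both landed)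

`CellFlux.unthreadedAnalyticOrIrrotational : CellFlux.UnthreadedAnalyticOrIrrotational` (Defs twin p692073 by name): an UNTHREADED bounded ancient mild
solution (`ν = 1`, `curl (v t) x = ∇T × (x − x₀)`), jointly `C^∞` on the open slab, is EITHER jointly real-analytic in its given frame OR irrotational at
every time.  One line from the landed kernel glue `analyticOrIrrotational_of` (p693177) fed with Σ-5a `unthreadedGaugeRigidity` (p720399, ns-qj-p1 g7:
analytic inertial frame + determinant-free rank dichotomy) and Z `zonalUnthreadedVorticityVanishes` (p700553, ns-qj-p1 g6: KNSS Thm 5.2 in a moving frame).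
HONEST LABEL: an information-grade rung below W1 (critic V22-P6 booking: Z = «KNSS Thm 5.2 in a moving frame»; Σ-5a = gauge rigidity); `PoloidalLiouville`
(1222), W1 and the summit stay OPEN; NO Navier–Stokes regularity statement is proved.  `--supports stmt-NavierStokesRegularity-1222 --as helper`.
[cite: KochNadirashviliSereginSverak2009, Thm 5.2; LemarieRieusset2016, Thm. 9.12]
-/

noncomputable section

-- the summit and its single sub-problem share the name (CONVENTIONS §1)
set_option linter.dupNamespace false

namespace Summit.NavierStokesRegularity.NavierStokesRegularity.Theorems.PoloidalLiouville.CellFlux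

/-- **Unthreaded ⇒ analytic-in-frame or irrotational** (unconditional): Σ-5a + Z through the kernel glue.
[cite: KochNadirashviliSereginSverak2009, Thm 5.2; LemarieRieusset2016, Thm. 9.12] -/
theorem unthreadedAnalyticOrIrrotational : UnthreadedAnalyticOrIrrotational :=
  analyticOrIrrotational_of unthreadedGaugeRigidity zonalUnthreadedVorticityVanishes

end Summit.NavierStokesRegularity.NavierStokesRegularity.Theorems.PoloidalLiouville.CellFlux

end
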